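import Literature.AlgebraicGeometry.ModuliOfAbelianVarieties.SiegelFamilyHumbertModularEmbedding
import Literature.AlgebraicGeometry.ModuliOfAbelianVarieties.SiegelFamilyHumbertEndomorphism
import Mathlib.Algebra.QuadraticAlgebra.Basic
import HarnessLib

/-!
# Real multiplication on Runge's standard model of the Humbert surface: the order `O = ℤ[ω]` acts on
# `X_Z`, `Z ∈ H_{(k,l,−1,0,0)}`, by "twice the regular representation", and Birkenhake–Wilhelm's `f₀` is `ω`

Layer `Literature/AlgebraicGeometry/ModuliOfAbelianVarieties`, namespace
`Literature.AlgebraicGeometry.ModuliOfAbelianVarieties.SiegelModuli`; lane `lit-hodgefound` (Track 2 foundations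
library, Layer A4), seat `lit-hodgefound-skel-4`, row **A4-64**, FILE 2. Sequel of FILE 1
(`SiegelFamilyHumbertModularEmbedding`: `quadDisc k l = l² + 4k`, the real roots `quadRoot k l i = σᵢ(ω)`, Runge's
`R = rungeMatrix k l`, Humbert's normal form `humbertNormalForm k l = (k, l, −1, 0, 0)`, the modular embedding
`modularEmbedding k l hΔ : (Fin 2 → ℍ) → 𝔥₂` with image `humbertLocus (k,l,−1,0,0)`) and of row A4-59′
(`SiegelFamilyHumbertEndomorphism`: B–W's `R₀ = humbertRatRep q`, `A_Z = humbertAnRep q Z`, Cor. 4.2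
`humbertRatRep_mem_endRingInt_iff`, Lemma 4.1 `rosati_humbertRatRep`, (6) `prinPeriod_humbertRatRep_mulVec`), on the
carriers of the tree's torus dictionary (`prinPeriod Z`, `endRingInt`, `symmEndInt`, `rosati`, `typeForm 1`) — all
consumed BY NAME. The order is Mathlib's `QuadraticAlgebra ℤ k l` (`ω = QuadraticAlgebra.omega`, `ω * ω = k • 1 + l • ω`,
universal property `QuadraticAlgebra.lift`).

## Sources followed, verbatim

* B. Runge, *Endomorphism rings of abelian surfaces and projective models of their moduli spaces*, Tohoku Math. J.
  **51** (1999) 283–303 (held text `paper:doi-10-2748-tmj-1178224764`), §4, p. 290: "We fix a `ℤ`-basis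
  `1 = ω₁, ω = ω₂` for `O` and denote by `R = (σᵢ(ωⱼ))` the Gram matrix of `F`. […] Let `x ∈ F` be arbitrary. Then
  `xωᵢ = Σⱼ Aᵢⱼωⱼ` for some matrix `A(x) = (Aᵢⱼ) ∈ Mₙ(ℚ)`. It is easy to check that `A(x) = ᵗRσ(x)ᵗR⁻¹` and
  `x ∈ O ⟺ A(x) ∈ M₂(ℤ)`. We fix the embedding `ℍ × ℍ ∋ (τ₁, τ₂) ↦ π[R] = ᵗR (τ₁ 0; 0 τ₂) R ∈ ℍ₂`, hence we get a
  diagram (twice the regular representation) `O ⊂ End(A_{π[R]}) ⊂ M₄(ℤ)`, `F ⊂ End⁰(A_{π[R]}) ⊂ M₄(ℚ)`", and p. 291: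
  "By the last theorem any period `τ` […] with `O ⊂ End(A_τ)` lies in a manifold `H(F)` as constructed above."
* Ch. Birkenhake, H. Wilhelm, *Humbert surfaces and the Kummer plane*, Trans. AMS **355** (2003) 1819–1841 (open AMS
  text), §4 p. 1827: "(9) `R₀ := (0 a 0 d; −c b −d 0; 0 e 0 −c; −e 0 a b)`, then by Lemma 4.1 the matrices `n1₄ + mR₀`
  are rational representations of symmetric endomorphisms of `X_Z` for all `n, m ∈ ℤ`. Corollary 4.2. `Z` satisfies
  equation (8) if and only if `ρ_{r,Z}(End^s(X_Z))` contains `R₀`. […] Proposition 4.3. […] `Tr_a(n_X + mf₀) = 2n + mb`,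
  `N_a(n_X + mf₀) = n² + nmb + m²(ac + de)`, and `Disc(n_X + mf₀) = m²(b² − 4ac − 4de)`"; p. 1828: "(10)
  `A_Z = ρ_{a,Z}(f₀) = (−dz₂ dz₁−c; −dz₃+a dz₂+b)`. […] Corollary 4.4. The subset `{n_X + mf₀ | m, n ∈ ℤ}` of
  `End^s(X_Z)` is a ring isomorphic to `ℤ[t]/(t² − bt + ac + de)`."; p. 1831, Prop. 4.9 (2): "If `(X, L₀) ∈ H_Δ`, then
  `End^s(X) ⊗_ℤ ℚ` contains the real quadratic number field `ℚ(√Δ)`".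
* C. T. McMullen, *Billiards and Teichmüller curves on Hilbert modular surfaces*, J. Amer. Math. Soc. **16** (2003),
  §6 Prop. 6.2: "For any `t ∈ ℍ^g`, the Abelian variety `A = ℂ^g/(ℤ^g ⊕ τℤ^g)`, `τ = f#(t)`, admits real
  multiplication by `K`" (with the eigenform coordinates in which `K` acts diagonally).
* N. D. Elkies, A. Kumar, *K3 surfaces and equations for Hilbert modular surfaces*, ANT **8** (2014), §3:
  "the subring `{(α, 0) ∈ M} = O_D` acts on `A⁺_z` by `ι(α) : (α, 0)·L_z(M) ↦ L_z((α, 0)·M)`, i.e.,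
  `(ζ₁, ζ₂) ↦ (σ₁(α)ζ₁, σ₂(α)ζ₂)`".

## Dictionary and contents (definitions with bodies and proved theorems; NO named fact, net debt 0)

For the normal form `q = (a, b, c, d, e) = (k, l, −1, 0, 0)` B–W's data specialise to `R₀ = diag((0 k; 1 l), (0 1; k l))`,
`A_Z = (0 1; k l)` (constant), `t² − bt + ac + de = t² − lt − k` — the minimal polynomial of `ω`. So:
* §1 **the regular representation** `regRep k l x = A(x) = (a b; kb a + lb)` of `x = a + bω` on `(1, ω)`
  (`regRep_omega : A(ω) = (0 1; k l)`, `regRep_mul`, the ring hom `regRepHom`, `regRep_injective`, `trace_regRep = Tr(x)`,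
  `det_regRep = N(x)` = Mathlib's `QuadraticAlgebra.norm`, `det_transpose_rungeMatrix_mul_self : det ᵗRR = Δ`); the real
  embeddings `realEmb h i : O →ₐ[ℤ] ℝ`, `ω ↦ σᵢ(ω)` (via `QuadraticAlgebra.lift`), distinct for `Δ > 0`; Runge's
  **`A(x) = ᵗRσ(x)ᵗR⁻¹`** as `regRep_mul_transpose_rungeMatrix : A(x)ᵗR = ᵗR diag(σ₁(x), σ₂(x))` and the eigenvector
  form `regRep_mulVec_eigenvector : A(x)(1, σᵢ(ω)) = σᵢ(x)(1, σᵢ(ω))`.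
* §2 **twice the regular representation** `rmRatRep k l x = ρ(x) = diag(ᵗA(x), A(x)) ∈ M₄(ℤ)` (ring hom `rmRatRepHom`,
  `rmRatRep_injective`); **`rmRatRep_omega : ρ(ω) = humbertRatRep (k,l,−1,0,0)`** — B–W's `f₀` IS multiplication by `ω`;
  `rmRatRep_eq_smul_one_add_smul : ρ(a + bω) = a·1 + b·R₀` and `range_rmRatRep : ρ(O) = {n·1 + m·R₀}` (Cor. 4.4);
  `rmRatRep_sqrtDisc_mul_self : ρ(2ω − l)² = Δ·1`; `rosati_rmRatRep` (every `ρ(x)` is Rosati-symmetric, Lemma 4.1);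
  **`rmRatRep_mem_endRingInt` / `rmRatRep_mem_symmEndInt`: for `Z ∈ H_{(k,l,−1,0,0)}`, `ρ(O) ⊆ End^s(X_Z)`** — real
  multiplication by the ORDER `O_Δ` (Prop. 4.9 (2) before `⊗ ℚ`); **`forall_rmRatRep_mem_endRingInt_iff` /
  `forall_rmRatRep_mem_symmEndInt_iff`: `ρ(O) ⊆ End(X_Z) ⟺ Z ∈ H_{(k,l,−1,0,0)}`** (Cor. 4.2; Runge: the periods with
  `O ⊂ End` through `ρ` are exactly `H(F)`); `rmRatRep_mem_symmEndInt_modularEmbedding`: every `X_{π(τ)}`,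
  `τ ∈ ℍ × ℍ`, has real multiplication by `O` (McMullen Prop. 6.2).
* §3 **the analytic representation**: `humbertAnRep_humbertNormalForm : A_Z = A(ω)` (eq. (10) at the normal form);
  **`prinPeriod_rmRatRep_mulVec : Φ_Z(ρ(x)v) = A(x)·Φ_Z(v)`** — `ι(x)` acts on `ℂ² ⊃ Λ_Z` by the INTEGER matrix `A(x)`
  (eq. (6) for all of `O`); `regRep_map_mul_transpose_rungeMatrix_complex : A(x)ᵗR = ᵗR diag(σ₁(x), σ₂(x))` over `ℂ` and
  `regRep_map_mulVec_eigenvector_complex` — in the coordinates `ζ = ᵗR⁻¹w`, in which `π(τ) = ᵗR diag(τ) R` is diagonal,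
  `ι(x)` is `diag(σ₁(x), σ₂(x))` (Elkies–Kumar's `ι(α)`, McMullen's eigenforms).

## Scope

NOT formalised here: the lattice dictionary `Λ_{π(τ)} = ᵗR·L_τ(O ⊕ O^∨)` with `E_Z = Tr(α₁β₂ − α₂β₁)` (FILE 3 of the
row); that `ρ(O)` is ALL of `End^s(X_Z)` / `End(X_Z)` for general `Z ∈ H_Δ` (B–W Cor. 4.6, needs a genericity notion);
the `ℚ`-algebra `F = O ⊗ ℚ → End_ℚ(X_Z)` as a Mathlib `NumberField` (the junction with p28's Shimura-family rows is by
name only); Runge's Theorem 2 / Humbert's lemma (transitivity of `Sp₄(ℤ)` on primitive relations of given `Δ`).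

## References

* [Runge1999EndomorphismRingsAbelianSurfaces] B. Runge, *Endomorphism rings of abelian surfaces and projective models
  of their moduli spaces*, Tohoku Math. J. 51 (1999) 283–303, §4 (pp. 290–291).
* [BirkenhakeWilhelm2003] Ch. Birkenhake, H. Wilhelm, *Humbert surfaces and the Kummer plane*, Trans. AMS 355 (2003)
  1819–1841, doi:10.1090/s0002-9947-03-03238-0, §4 eq. (6) (p. 1826), Lemma 4.1, eq. (9), Cor. 4.2, Prop. 4.3
  (p. 1827), eq. (10), Cor. 4.4 (p. 1828), Prop. 4.9 (2) (p. 1831).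
* [McMullen2003BilliardsTeichmuellerCurves] C. T. McMullen, *Billiards and Teichmüller curves on Hilbert modular
  surfaces*, J. Amer. Math. Soc. 16 (2003) 857–885, §6 Prop. 6.2.
* [ElkiesKumar2014HilbertModularSurfaces] N. D. Elkies, A. Kumar, *K3 surfaces and equations for Hilbert modular
  surfaces*, Algebra & Number Theory 8 (2014) 2297–2411, §3.
* [Lange2023AbelianVarietiesComplex] H. Lange, *Abelian Varieties over the Complex Numbers*, Springer (2023), §1.1.2
  Prop. 1.1.6, §2.4.1–2.4.2 (the carriers `endRingInt`, `symmEndInt`, `rosati`).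
-/

noncomputable section

open Matrix Complex Module Function Set
open scoped UpperHalfPlane

namespace Literature.AlgebraicGeometry.ModuliOfAbelianVarieties

namespace SiegelModuli

open Literature.NumberTheory.Automorphic (siegelUpperHalfSpace)
open Literature.NumberTheory.ModularForms.SiegelUpperHalfSpace
open Literature.Geometry.Kaehler Literature.Geometry.Kaehler.ComplexTorus
open Literature.Analysis.Complex Literature.LinearAlgebra.Alternating
open Sum

/-! ## §1 The order `O = ℤ[ω]` (Mathlib's `QuadraticAlgebra ℤ k l`, `ω² = k + lω`) and Runge's regular
representation `A(x)` on the basis `(1, ω)` -/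

section RegularRep

variable (k l : ℤ)

/-- **Runge's regular representation `A(x)` of `x = a + bω ∈ O = ℤ[ω]` on the `ℤ`-basis `(ω₁, ω₂) = (1, ω)`:
`xωᵢ = Σⱼ A(x)ᵢⱼ ωⱼ`, i.e. `A(a + bω) = (a b; kb a + lb)`** ("Let `x ∈ F` be arbitrary. Then `xωᵢ = Σⱼ Aᵢⱼωⱼ` for some
matrix `A(x) = (Aᵢⱼ) ∈ Mₙ(ℚ)` … `x ∈ O ⟺ A(x) ∈ M₂(ℤ)`"). [cite: Runge1999EndomorphismRingsAbelianSurfaces, §4 p. 290] -/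
def regRep (x : QuadraticAlgebra ℤ k l) : Matrix (Fin 2) (Fin 2) ℤ := !![x.re, x.im; k * x.im, x.re + l * x.im]

/-- Unfolding of `regRep`. [cite: Runge1999EndomorphismRingsAbelianSurfaces, §4 p. 290] -/
theorem regRep_apply (x : QuadraticAlgebra ℤ k l) : regRep k l x = !![x.re, x.im; k * x.im, x.re + l * x.im] := rfl

/-- `A(1) = 1`. [cite: Runge1999EndomorphismRingsAbelianSurfaces, §4 p. 290] -/
@[simp] theorem regRep_one : regRep k l 1 = 1 := by
  ext i j; fin_cases i <;> fin_cases j <;> simp [regRep, QuadraticAlgebra.re_one, QuadraticAlgebra.im_one]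

/-- **`A(ω) = (0 1; k l)`** (`ω·1 = ω`, `ω·ω = k + lω`). [cite: Runge1999EndomorphismRingsAbelianSurfaces, §4 p. 290] -/
theorem regRep_omega : regRep k l QuadraticAlgebra.omega = !![0, 1; k, l] := by
  ext i j; fin_cases i <;> fin_cases j <;> simp [regRep]

/-- `A(a) = a·1` for `a ∈ ℤ`. [cite: Runge1999EndomorphismRingsAbelianSurfaces, §4 p. 290] -/
theorem regRep_intCast (a : ℤ) : regRep k l (a : QuadraticAlgebra ℤ k l) = a • (1 : Matrix (Fin 2) (Fin 2) ℤ) := by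
  ext i j; fin_cases i <;> fin_cases j <;> simp [regRep]

/-- `A` is additive. [cite: Runge1999EndomorphismRingsAbelianSurfaces, §4 p. 290] -/
theorem regRep_add (x y : QuadraticAlgebra ℤ k l) : regRep k l (x + y) = regRep k l x + regRep k l y := by
  ext i j; fin_cases i <;> fin_cases j <;> simp [regRep] <;> ring

/-- **`A(xy) = A(x)A(y)`** (the regular representation is multiplicative; `O` is commutative).
[cite: Runge1999EndomorphismRingsAbelianSurfaces, §4 p. 290] -/
theorem regRep_mul (x y : QuadraticAlgebra ℤ k l) : regRep k l (x * y) = regRep k l x * regRep k l y := by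
  ext i j
  fin_cases i <;> fin_cases j <;>
    simp [regRep, Matrix.mul_apply, Fin.sum_univ_two, QuadraticAlgebra.re_mul, QuadraticAlgebra.im_mul] <;> ring

/-- `A(x)` and `A(y)` commute. [cite: Runge1999EndomorphismRingsAbelianSurfaces, §4 p. 290] -/
theorem regRep_comm (x y : QuadraticAlgebra ℤ k l) : regRep k l x * regRep k l y = regRep k l y * regRep k l x := by
  rw [← regRep_mul, ← regRep_mul, mul_comm]

/-- `x = A(x)₀₀ + A(x)₀₁ ω`: the first row of `A(x)` is the coordinate vector of `x` (`x·1 = x`), so `A` is injective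
("`x ∈ O ⟺ A(x) ∈ M₂(ℤ)`"). [cite: Runge1999EndomorphismRingsAbelianSurfaces, §4 p. 290] -/
theorem regRep_injective : Injective (regRep k l) := fun x y h ↦ by
  have h0 := congrFun (congrFun h 0) 0
  have h1 := congrFun (congrFun h 0) 1
  simp [regRep] at h0 h1
  exact QuadraticAlgebra.ext h0 h1

/-- **The regular representation as a ring homomorphism `O → M₂(ℤ)`.** [cite: Runge1999EndomorphismRingsAbelianSurfaces, §4 p. 290] -/
def regRepHom : QuadraticAlgebra ℤ k l →+* Matrix (Fin 2) (Fin 2) ℤ where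
  toFun := regRep k l
  map_one' := regRep_one k l
  map_mul' := regRep_mul k l
  map_zero' := by ext i j; fin_cases i <;> fin_cases j <;> simp [regRep]
  map_add' := regRep_add k l

/-- `regRepHom` is `regRep`. [cite: Runge1999EndomorphismRingsAbelianSurfaces, §4 p. 290] -/
@[simp] theorem regRepHom_apply (x : QuadraticAlgebra ℤ k l) : regRepHom k l x = regRep k l x := rfl

/-- `tr A(x) = Tr_{F/ℚ}(x) = 2a + lb`. [cite: Runge1999EndomorphismRingsAbelianSurfaces, §4 p. 290] -/
theorem trace_regRep (x : QuadraticAlgebra ℤ k l) : (regRep k l x).trace = 2 * x.re + l * x.im := by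
  simp [regRep, Matrix.trace, Fin.sum_univ_two]; ring

/-- `det A(x) = N_{F/ℚ}(x) = a² + lab − kb²` — Mathlib's `QuadraticAlgebra.norm`. [cite: Runge1999EndomorphismRingsAbelianSurfaces, §4 p. 290] -/
theorem det_regRep (x : QuadraticAlgebra ℤ k l) : (regRep k l x).det = QuadraticAlgebra.norm x := by
  rw [regRep, Matrix.det_fin_two_of, QuadraticAlgebra.norm_def]; ring

/-- **`det(ᵗRR) = det(Tr(ωᵢωⱼ)) = Δ`: the discriminant of the trace form of `O` on `(1, ω)` is `l² + 4k`.**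
[cite: Runge1999EndomorphismRingsAbelianSurfaces, §4 p. 290] -/
theorem det_transpose_rungeMatrix_mul_self (h : 0 ≤ quadDisc k l) :
    ((rungeMatrix k l)ᵀ * rungeMatrix k l).det = (quadDisc k l : ℝ) := by
  rw [transpose_rungeMatrix_mul_self h, Matrix.det_fin_two_of, quadDisc]; push_cast; ring

variable {k l}

/-- **The real embeddings `σᵢ : O → ℝ`, `a + bω ↦ a + bσᵢ(ω)`** (as `ℤ`-algebra maps; `σᵢ(ω)² = k + lσᵢ(ω)` for
`Δ ≥ 0`; Runge's projections `σ₁, σ₂ : F ⊗ ℝ = ℝ ⊕ ℝ → ℝ`). [cite: Runge1999EndomorphismRingsAbelianSurfaces, §4 p. 290] -/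
def realEmb (h : 0 ≤ quadDisc k l) (i : Fin 2) : QuadraticAlgebra ℤ k l →ₐ[ℤ] ℝ :=
  QuadraticAlgebra.lift ⟨quadRoot k l i, by
    rw [zsmul_eq_mul, zsmul_eq_mul, mul_one, ← sq, quadRoot_sq h i]; ring⟩

/-- `σᵢ(a + bω) = a + bσᵢ(ω)`. [cite: Runge1999EndomorphismRingsAbelianSurfaces, §4 p. 290] -/
theorem realEmb_apply (h : 0 ≤ quadDisc k l) (i : Fin 2) (x : QuadraticAlgebra ℤ k l) :
    realEmb h i x = x.re + x.im * quadRoot k l i := by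
  rw [realEmb, QuadraticAlgebra.lift_apply_apply, zsmul_eq_mul, zsmul_eq_mul, mul_one]

/-- `σᵢ(ω) = quadRoot k l i`. [cite: Runge1999EndomorphismRingsAbelianSurfaces, §4 p. 290] -/
theorem realEmb_omega (h : 0 ≤ quadDisc k l) (i : Fin 2) :
    realEmb h i QuadraticAlgebra.omega = quadRoot k l i := by
  rw [realEmb_apply]; simp

/-- **The two real embeddings are distinct for `Δ > 0`**: `σ₁(ω) ≠ σ₂(ω)` (`σ₁(ω) − σ₂(ω) = √Δ`), so `σ₁ ≠ σ₂` — also in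
the split case `Δ = f²`, `F ≅ ℚ × ℚ`. [cite: Runge1999EndomorphismRingsAbelianSurfaces, §4 p. 290] -/
theorem realEmb_zero_ne_one (h : 0 < quadDisc k l) : realEmb h.le 0 ≠ realEmb h.le 1 := fun e ↦
  quadRoot_zero_ne_one h (by rw [← realEmb_omega h.le 0, ← realEmb_omega h.le 1, e])

/-- **"`A(x) = ᵗRσ(x)ᵗR⁻¹`" as the eigenvector statement: the rows `(1, σᵢ(ω))` of `R` are eigenvectors of `A(x)` with
eigenvalues `σᵢ(x)`**, `A(x)·(1, σᵢ(ω)) = σᵢ(x)·(1, σᵢ(ω))`. [cite: Runge1999EndomorphismRingsAbelianSurfaces, §4 p. 290] -/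
theorem regRep_mulVec_eigenvector (h : 0 ≤ quadDisc k l) (x : QuadraticAlgebra ℤ k l) (i : Fin 2) :
    (regRep k l x).map (Int.cast : ℤ → ℝ) *ᵥ ![1, quadRoot k l i] = realEmb h i x • ![1, quadRoot k l i] := by
  have hq := quadRoot_sq h i
  rw [realEmb_apply]
  funext j
  fin_cases j
  · simp [regRep, Matrix.mulVec, dotProduct, Fin.sum_univ_two]
  · simp [regRep, Matrix.mulVec, dotProduct, Fin.sum_univ_two]
    linear_combination (-(x.im : ℝ)) * hq

/-- **Runge's `A(x)ᵗR = ᵗRσ(x)`**, `σ(x) = diag(σ₁(x), σ₂(x))`: the regular representation is diagonalised by `ᵗR`.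
[cite: Runge1999EndomorphismRingsAbelianSurfaces, §4 p. 290] -/
theorem regRep_mul_transpose_rungeMatrix (h : 0 ≤ quadDisc k l) (x : QuadraticAlgebra ℤ k l) :
    (regRep k l x).map (Int.cast : ℤ → ℝ) * (rungeMatrix k l)ᵀ =
      (rungeMatrix k l)ᵀ * Matrix.diagonal (fun i ↦ realEmb h i x) := by
  have h0 := quadRoot_sq h 0
  have h1 := quadRoot_sq h 1
  simp only [realEmb_apply]
  ext i j
  fin_cases i <;> fin_cases j
  · simp [regRep, rungeMatrix, Matrix.mul_apply, Fin.sum_univ_two, Matrix.diagonal]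
  · simp [regRep, rungeMatrix, Matrix.mul_apply, Fin.sum_univ_two, Matrix.diagonal]
  · simp [regRep, rungeMatrix, Matrix.mul_apply, Fin.sum_univ_two, Matrix.diagonal]
    linear_combination (-(x.im : ℝ)) * h0
  · simp [regRep, rungeMatrix, Matrix.mul_apply, Fin.sum_univ_two, Matrix.diagonal]
    linear_combination (-(x.im : ℝ)) * h1

end RegularRep

/-! ## §2 "Twice the regular representation": the rational representation `O → M₄(ℤ)` of real multiplication on
`X_Z`, `Z ∈ H(F)`, and Birkenhake–Wilhelm's `f₀` -/

section RationalRep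

variable (k l : ℤ)

/-- **Twice the regular representation: `ρ(x) = diag(ᵗA(x), A(x)) ∈ M₄(ℤ)`** on the lattice basis `(x₁, x₂, y₁, y₂)` of
`X_Z = ℂ²/(Z, 1₂)ℤ⁴` ("we get a diagram (twice the regular representation) `O ⊂ End(A_{π[R]}) ⊂ M₄(ℤ)`"; the
transpose on the first block is forced by `A(x)Z = Zᵗ A(x)` for `Z = ᵗR diag(τ) R`, see `prinPeriod_rmRatRep_mulVec`).
[cite: Runge1999EndomorphismRingsAbelianSurfaces, §4 pp. 290–291] -/
def rmRatRep (x : QuadraticAlgebra ℤ k l) : Matrix (Fin 2 ⊕ Fin 2) (Fin 2 ⊕ Fin 2) ℤ :=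
  Matrix.fromBlocks (regRep k l x)ᵀ 0 0 (regRep k l x)

/-- Unfolding of `rmRatRep`. [cite: Runge1999EndomorphismRingsAbelianSurfaces, §4 pp. 290–291] -/
theorem rmRatRep_apply (x : QuadraticAlgebra ℤ k l) :
    rmRatRep k l x = Matrix.fromBlocks (regRep k l x)ᵀ 0 0 (regRep k l x) := rfl

/-- `ρ(1) = 1`. [cite: Runge1999EndomorphismRingsAbelianSurfaces, §4 pp. 290–291] -/
@[simp] theorem rmRatRep_one : rmRatRep k l 1 = 1 := by
  rw [rmRatRep, regRep_one, Matrix.transpose_one, Matrix.fromBlocks_one]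

/-- `ρ` is additive. [cite: Runge1999EndomorphismRingsAbelianSurfaces, §4 pp. 290–291] -/
theorem rmRatRep_add (x y : QuadraticAlgebra ℤ k l) : rmRatRep k l (x + y) = rmRatRep k l x + rmRatRep k l y := by
  rw [rmRatRep, rmRatRep, rmRatRep, regRep_add, Matrix.transpose_add, Matrix.fromBlocks_add, add_zero]

/-- **`ρ(xy) = ρ(x)ρ(y)`** (on the transposed block because `A(x)` and `A(y)` commute).
[cite: Runge1999EndomorphismRingsAbelianSurfaces, §4 pp. 290–291] -/
theorem rmRatRep_mul (x y : QuadraticAlgebra ℤ k l) : rmRatRep k l (x * y) = rmRatRep k l x * rmRatRep k l y := by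
  rw [rmRatRep, rmRatRep, rmRatRep, Matrix.fromBlocks_multiply, regRep_mul]
  simp only [Matrix.mul_zero, Matrix.zero_mul, add_zero, zero_add]
  rw [regRep_comm, Matrix.transpose_mul]

/-- **The rational representation as a ring homomorphism `O = ℤ[ω] → M₄(ℤ)`.**
[cite: Runge1999EndomorphismRingsAbelianSurfaces, §4 pp. 290–291] -/
def rmRatRepHom : QuadraticAlgebra ℤ k l →+* Matrix (Fin 2 ⊕ Fin 2) (Fin 2 ⊕ Fin 2) ℤ where
  toFun := rmRatRep k l
  map_one' := rmRatRep_one k l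
  map_mul' := rmRatRep_mul k l
  map_zero' := by rw [rmRatRep, show regRep k l 0 = 0 from map_zero (regRepHom k l)]; simp
  map_add' := rmRatRep_add k l

/-- `rmRatRepHom` is `rmRatRep`. [cite: Runge1999EndomorphismRingsAbelianSurfaces, §4 pp. 290–291] -/
@[simp] theorem rmRatRepHom_apply (x : QuadraticAlgebra ℤ k l) : rmRatRepHom k l x = rmRatRep k l x := rfl

/-- `ρ` is injective (`x ∈ O ⟺ A(x) ∈ M₂(ℤ)`: `O ≅ ρ(O) ⊆ M₄(ℤ)`). [cite: Runge1999EndomorphismRingsAbelianSurfaces, §4 pp. 290–291] -/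
theorem rmRatRep_injective : Injective (rmRatRep k l) := fun x y h ↦ by
  have h' := congrArg Matrix.toBlocks₂₂ h
  simp only [rmRatRep, Matrix.toBlocks_fromBlocks₂₂] at h'
  exact regRep_injective k l h'

/-- **Birkenhake–Wilhelm's `f₀` is multiplication by `ω`: `R₀(k, l, −1, 0, 0) = ρ(ω) = diag(ᵗA(ω), A(ω))`** (eq. (9):
`R₀ = (0 a 0 d; −c b −d 0; 0 e 0 −c; −e 0 a b)` at `(a,b,c,d,e) = (k,l,−1,0,0)` is `diag((0 k; 1 l), (0 1; k l))`;
`Tr_a(f₀) = b = l`, `N_a(f₀) = ac + de = −k` as for `ω`). [cite: BirkenhakeWilhelm2003, §4 eq. (9) and Prop. 4.3 (p. 1827)] [cite: Runge1999EndomorphismRingsAbelianSurfaces, §4 pp. 290–291] -/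
theorem rmRatRep_omega : rmRatRep k l QuadraticAlgebra.omega = humbertRatRep (humbertNormalForm k l) := by
  rw [rmRatRep, regRep_omega, humbertRatRep]
  ext i j
  rcases i with i | i <;> rcases j with j | j <;> fin_cases i <;> fin_cases j <;> simp [humbertNormalForm]

/-- `ρ(a + bω) = a·1 + b·R₀`. [cite: Runge1999EndomorphismRingsAbelianSurfaces, §4 pp. 290–291] [cite: BirkenhakeWilhelm2003, §4 Cor. 4.4 (p. 1828)] -/
theorem rmRatRep_eq_smul_one_add_smul (x : QuadraticAlgebra ℤ k l) :
    rmRatRep k l x = x.re • (1 : Matrix (Fin 2 ⊕ Fin 2) (Fin 2 ⊕ Fin 2) ℤ) + x.im • humbertRatRep (humbertNormalForm k l) := by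
  have hA : regRep k l x = x.re • (1 : Matrix (Fin 2) (Fin 2) ℤ) + x.im • regRep k l QuadraticAlgebra.omega := by
    ext i j
    simp only [Matrix.add_apply, Matrix.smul_apply, smul_eq_mul, Matrix.one_apply, regRep_omega]
    fin_cases i <;> fin_cases j <;> simp [regRep, mul_comm]
  rw [← rmRatRep_omega, rmRatRep, rmRatRep, hA, ← Matrix.fromBlocks_one, Matrix.fromBlocks_smul,
    Matrix.fromBlocks_smul, Matrix.fromBlocks_add, smul_zero, smul_zero, add_zero, Matrix.transpose_add,
    Matrix.transpose_smul, Matrix.transpose_smul, Matrix.transpose_one]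

/-- **Cor. 4.4 as a RING isomorphism onto its image: `ℤ[t]/(t² − bt + ac + de) = O ≅ {n·1_X + m·f₀} = ρ(O)`**, i.e.
the subring `{n + m f₀}` of `End(X_Z)` is the image of the injective ring homomorphism `ρ` with `ρ(ω) = f₀`
(B–W record `f₀² = b f₀ − (ac + de)`; here `= lf₀ + k`). [cite: BirkenhakeWilhelm2003, §4 Cor. 4.4 (p. 1828)] [cite: Runge1999EndomorphismRingsAbelianSurfaces, §4 pp. 290–291] -/
theorem range_rmRatRep :
    Set.range (rmRatRep k l) =
      {A | ∃ n m : ℤ, A = n • (1 : Matrix (Fin 2 ⊕ Fin 2) (Fin 2 ⊕ Fin 2) ℤ) + m • humbertRatRep (humbertNormalForm k l)} := by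
  ext A
  constructor
  · rintro ⟨x, rfl⟩
    exact ⟨x.re, x.im, rmRatRep_eq_smul_one_add_smul k l x⟩
  · rintro ⟨n, m, rfl⟩
    exact ⟨⟨n, m⟩, rmRatRep_eq_smul_one_add_smul k l _⟩

/-- **`ρ(2ω − l)² = Δ·1`: `√Δ = 2ω − l = ⟨−l, 2⟩ ∈ O` acts on `X_Z`** (B–W Prop. 4.3 `Disc(n + mf₀) = m²Δ`; Prop. 4.9 (2)
"`End^s(X) ⊗ ℚ` contains `ℚ(√Δ)`" — here the whole ORDER `O_Δ` does). [cite: BirkenhakeWilhelm2003, §4 Prop. 4.3 (p. 1828) and Prop. 4.9 (2) (p. 1831)] -/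
theorem rmRatRep_sqrtDisc_mul_self :
    rmRatRep k l (⟨-l, 2⟩ : QuadraticAlgebra ℤ k l) * rmRatRep k l (⟨-l, 2⟩ : QuadraticAlgebra ℤ k l) =
      quadDisc k l • (1 : Matrix (Fin 2 ⊕ Fin 2) (Fin 2 ⊕ Fin 2) ℤ) := by
  have h : rmRatRep k l (⟨-l, 2⟩ : QuadraticAlgebra ℤ k l) =
      (2 : ℤ) • humbertRatRep (humbertNormalForm k l) - l • (1 : Matrix _ _ ℤ) := by
    rw [rmRatRep_eq_smul_one_add_smul]
    show (-l) • (1 : Matrix (Fin 2 ⊕ Fin 2) (Fin 2 ⊕ Fin 2) ℤ) + (2 : ℤ) • humbertRatRep (humbertNormalForm k l) = _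
    rw [neg_smul, neg_add_eq_sub]
  have key := two_smul_humbertRatRep_sub_sq (humbertNormalForm k l)
  have h1 : humbertNormalForm k l 1 = l := rfl
  rw [h1, humbertInvariant_humbertNormalForm] at key
  rw [h]
  exact key

variable {k l}

/-- `det E₀ = 1` is a unit (for the Rosati involution of the principal polarisation). [folklore] -/
private theorem isUnit_det_typeForm_one' : IsUnit (typeForm (fun _ : Fin 2 ↦ 1)).det := by
  rw [typeForm_one_eq_neg_J, Matrix.det_neg, Fintype.card_sum, Fintype.card_fin]
  norm_num
  exact Matrix.isUnit_det_J _ _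

/-- **Every `ρ(x)` is symmetric for the Rosati involution of the principal polarisation `E_Z`** (`ρ(x) = a·1 + b·f₀` and
`f₀' = f₀`, Lemma 4.1; so `ρ(O)` consists of symmetric matrices — "`End^s(X)` contains a ring isomorphic to `ℤ[t]/(p(t))`").
[cite: BirkenhakeWilhelm2003, §4 Lemma 4.1 (p. 1827) and Cor. 4.4 (p. 1828)] -/
theorem rosati_rmRatRep (x : QuadraticAlgebra ℤ k l) :
    rosati (typeForm fun _ : Fin 2 ↦ 1) (rmRatRep k l x) = rmRatRep k l x := by
  rw [rmRatRep_eq_smul_one_add_smul, rosati_add, rosati_smul, rosati_smul, rosati_one isUnit_det_typeForm_one',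
    rosati_humbertRatRep]

/-- **`ρ(O) ⊆ End(X_Z)` for `Z ∈ H_{(k,l,−1,0,0)}`**: on the Humbert locus of the normal form every `ρ(x)`, `x ∈ O`, is
the rational representation of an endomorphism of `X_Z` (`ρ(x) = a·1 + b·f₀`, `f₀ ∈ End(X_Z)` by Cor. 4.2 — row A4-59′
`humbertRatRep_mem_endRingInt`; "`O ⊂ End(A_{π[R]}) ⊂ M₄(ℤ)`"). [cite: Runge1999EndomorphismRingsAbelianSurfaces, §4 pp. 290–291] [cite: BirkenhakeWilhelm2003, §4 Cor. 4.2 (p. 1827)] -/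
theorem rmRatRep_mem_endRingInt {Z : siegelUpperHalfSpace 2}
    (hZ : Z ∈ humbertLocus (fun i ↦ (humbertNormalForm k l i : ℂ))) (x : QuadraticAlgebra ℤ k l) :
    rmRatRep k l x ∈ endRingInt (prinPeriod Z : (Fin 2 ⊕ Fin 2 → ℝ) ≃L[ℝ] (Fin 2 → ℂ)) := by
  rw [rmRatRep_eq_smul_one_add_smul]
  exact add_mem (Subring.zsmul_mem _ (Subring.one_mem _) _)
    (Subring.zsmul_mem _ (humbertRatRep_mem_endRingInt (mem_humbertLocus_iff.1 hZ)) _)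

/-- **`ρ(O) ⊆ End^s(X_Z)` on `H_{(k,l,−1,0,0)}`: real multiplication by the ORDER `O_Δ = ℤ[ω]` through symmetric
endomorphisms** (Prop. 4.9 (2): "If `(X, L₀) ∈ H_Δ`, then `End^s(X) ⊗_ℤ ℚ` contains the real quadratic number field
`ℚ(√Δ)`" — here before `⊗ ℚ` and for every `Δ = l² + 4k > 0`, squares included).
[cite: BirkenhakeWilhelm2003, §4 Prop. 4.9 (2) (p. 1831)] [cite: Runge1999EndomorphismRingsAbelianSurfaces, §4 pp. 290–291] -/
theorem rmRatRep_mem_symmEndInt {Z : siegelUpperHalfSpace 2}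
    (hZ : Z ∈ humbertLocus (fun i ↦ (humbertNormalForm k l i : ℂ))) (x : QuadraticAlgebra ℤ k l) :
    rmRatRep k l x ∈ symmEndInt (prinPeriod Z : (Fin 2 ⊕ Fin 2 → ℝ) ≃L[ℝ] (Fin 2 → ℂ)) (typeForm fun _ : Fin 2 ↦ 1) :=
  (mem_symmEndInt_iff _).2 ⟨rmRatRep_mem_endRingInt hZ x, rosati_rmRatRep x⟩

/-- **`ρ(O) ⊆ End(X_Z) ⟺ Z ∈ H_{(k,l,−1,0,0)}`** — the locus in `𝔥₂` where THIS lattice action of `O` is holomorphic is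
exactly the Humbert locus of the normal form (⟸ above; ⟹ by `x = ω`, Cor. 4.2). Runge: "any period `τ` … with
`O ⊂ End(A_τ)` lies in a manifold `H(F)` as constructed above" (for the embedding `ρ`; the statement up to
`Sp₄(ℤ)`-conjugacy of the embedding is Runge's Theorem 2, not formalised here). [cite: Runge1999EndomorphismRingsAbelianSurfaces, §4 Thm. 2 and pp. 290–291] [cite: BirkenhakeWilhelm2003, §4 Cor. 4.2 (p. 1827)] -/
theorem forall_rmRatRep_mem_endRingInt_iff (Z : siegelUpperHalfSpace 2) :
    (∀ x : QuadraticAlgebra ℤ k l, rmRatRep k l x ∈ endRingInt (prinPeriod Z : (Fin 2 ⊕ Fin 2 → ℝ) ≃L[ℝ] (Fin 2 → ℂ))) ↔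
      Z ∈ humbertLocus (fun i ↦ (humbertNormalForm k l i : ℂ)) := by
  refine ⟨fun h ↦ ?_, fun hZ x ↦ rmRatRep_mem_endRingInt hZ x⟩
  rw [← humbertRatRep_mem_endRingInt_iff, ← rmRatRep_omega]
  exact h _

/-- **`ρ(O) ⊆ End^s(X_Z) ⟺ Z ∈ H_{(k,l,−1,0,0)}`** (Cor. 4.2: "`Z` satisfies equation (8) if and only if
`ρ_{r,Z}(End^s(X_Z))` contains `R₀`", with `R₀ = ρ(ω)` and `ρ(O) = {n + mR₀}`).
[cite: BirkenhakeWilhelm2003, §4 Cor. 4.2 (p. 1827) and Cor. 4.4 (p. 1828)] [cite: Runge1999EndomorphismRingsAbelianSurfaces, §4 pp. 290–291] -/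
theorem forall_rmRatRep_mem_symmEndInt_iff (Z : siegelUpperHalfSpace 2) :
    (∀ x : QuadraticAlgebra ℤ k l, rmRatRep k l x ∈
        symmEndInt (prinPeriod Z : (Fin 2 ⊕ Fin 2 → ℝ) ≃L[ℝ] (Fin 2 → ℂ)) (typeForm fun _ : Fin 2 ↦ 1)) ↔
      Z ∈ humbertLocus (fun i ↦ (humbertNormalForm k l i : ℂ)) :=
  ⟨fun h ↦ (forall_rmRatRep_mem_endRingInt_iff Z).1 fun x ↦ ((mem_symmEndInt_iff _).1 (h x)).1,
    fun hZ x ↦ rmRatRep_mem_symmEndInt hZ x⟩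

/-- **On the modular image every `X_{π(τ)}` has real multiplication by `O`**: `ρ(O) ⊆ End^s(X_{π(τ)})` for all
`τ ∈ ℍ × ℍ` (McMullen's Prop. 6.2: "the Abelian variety `A = ℂ^g/(ℤ^g ⊕ τℤ^g)`, `τ = f#(t)`, admits real multiplication
by `K`"; Runge's `O ⊂ End(A_{π[R]})`). [cite: McMullen2003BilliardsTeichmuellerCurves, §6 Prop. 6.2] [cite: Runge1999EndomorphismRingsAbelianSurfaces, §4 pp. 290–291] -/
theorem rmRatRep_mem_symmEndInt_modularEmbedding (hΔ : 0 < quadDisc k l) (τ : Fin 2 → ℍ) (x : QuadraticAlgebra ℤ k l) :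
    rmRatRep k l x ∈ symmEndInt (prinPeriod (modularEmbedding k l hΔ τ) : (Fin 2 ⊕ Fin 2 → ℝ) ≃L[ℝ] (Fin 2 → ℂ))
      (typeForm fun _ : Fin 2 ↦ 1) :=
  rmRatRep_mem_symmEndInt (modularEmbedding_mem_humbertLocus hΔ τ) x

end RationalRep

/-! ## §3 The analytic representation: `ι(x)` acts on `ℂ²` by the integer matrix `A(x)`, diagonalised by `ᵗR` with
eigenvalues `σ₁(x), σ₂(x)` -/

section AnalyticRep

variable (k l : ℤ)

/-- **B–W's analytic representation `A_Z = (−dz₂ dz₁−c; −dz₃+a dz₂+b)` of `f₀` at the normal form is the CONSTANT integer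
matrix `A(ω) = (0 1; k l)`** (`d = 0`: it does not depend on `Z`). [cite: BirkenhakeWilhelm2003, §4 eq. (10) (p. 1828)] [cite: Runge1999EndomorphismRingsAbelianSurfaces, §4 p. 290] -/
theorem humbertAnRep_humbertNormalForm (Z : Matrix (Fin 2) (Fin 2) ℂ) :
    humbertAnRep (humbertNormalForm k l) Z = (regRep k l QuadraticAlgebra.omega).map (Int.cast : ℤ → ℂ) := by
  rw [regRep_omega]
  ext i j; fin_cases i <;> fin_cases j <;> simp [humbertAnRep, humbertNormalForm]

variable {k l}

/-- **The analytic representation of `ι(x)`, `x ∈ O`, on `X_Z = ℂ²/(Z, 1₂)ℤ⁴`, `Z ∈ H_{(k,l,−1,0,0)}`, is the INTEGER matrix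
`A(x)`: `Φ_Z(ρ(x)v) = A(x)·Φ_Z(v)`** (`Φ_Z(m, n) = Zm + n`; for `x = ω` this is B–W's (6) `A_Z (Z, 1₂) = (Z, 1₂) R₀` with
`A_Z = A(ω)`, and it extends by linearity since `ρ(a + bω) = a + bρ(ω)`, `A(a + bω) = a + bA(ω)`).
[cite: BirkenhakeWilhelm2003, §4 eq. (6) (p. 1826) and eq. (10) (p. 1828)] [cite: Runge1999EndomorphismRingsAbelianSurfaces, §4 p. 290] -/
theorem prinPeriod_rmRatRep_mulVec {Z : siegelUpperHalfSpace 2}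
    (hZ : Z ∈ humbertLocus (fun i ↦ (humbertNormalForm k l i : ℂ))) (x : QuadraticAlgebra ℤ k l)
    (v : Fin 2 ⊕ Fin 2 → ℝ) :
    prinPeriod Z ((rmRatRep k l x).map (Int.cast : ℤ → ℝ) *ᵥ v) =
      (regRep k l x).map (Int.cast : ℤ → ℂ) *ᵥ prinPeriod Z v := by
  have hω := prinPeriod_humbertRatRep_mulVec (q := humbertNormalForm k l) (Z := Z) (mem_humbertLocus_iff.1 hZ) v
  have eL : (rmRatRep k l x).map (Int.cast : ℤ → ℝ) *ᵥ v =
      (x.re : ℝ) • v + (x.im : ℝ) • ((humbertRatRep (humbertNormalForm k l)).map (Int.cast : ℤ → ℝ) *ᵥ v) := by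
    funext i
    rcases i with i | i <;> fin_cases i <;>
      simp [rmRatRep, regRep, humbertRatRep, humbertNormalForm, Matrix.mulVec, dotProduct, Fintype.sum_sum_type,
        Fin.sum_univ_two] <;> ring
  have eR : ∀ w : Fin 2 → ℂ, (regRep k l x).map (Int.cast : ℤ → ℂ) *ᵥ w =
      (x.re : ℂ) • w + (x.im : ℂ) • (humbertAnRep (humbertNormalForm k l) (Z : Matrix (Fin 2) (Fin 2) ℂ) *ᵥ w) := by
    intro w
    funext i
    fin_cases i
    · simp [regRep, humbertAnRep, humbertNormalForm, Matrix.mulVec, dotProduct, Fin.sum_univ_two]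
    · simp [regRep, humbertAnRep, humbertNormalForm, Matrix.mulVec, dotProduct, Fin.sum_univ_two]
      ring
  rw [eL, eR, map_add, map_smul, map_smul, ← hω]
  funext i
  simp only [Pi.add_apply, Pi.smul_apply, Complex.real_smul, smul_eq_mul, Complex.ofReal_intCast]

/-- **Runge's `A(x) = ᵗRσ(x)ᵗR⁻¹` over `ℂ`: `A(x)·ᵗR = ᵗR·diag(σ₁(x), σ₂(x))`** — in the coordinates `ζ = ᵗR⁻¹w` of `ℂ²`
(in which `π(τ) = ᵗR diag(τ) R` is diagonalised) real multiplication by `x` is `diag(σ₁(x), σ₂(x))`: Elkies–Kumar's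
"`ι(α)(ζ₁, ζ₂) ↦ (σ₁(α)ζ₁, σ₂(α)ζ₂)`", McMullen's eigenform coordinates.
[cite: Runge1999EndomorphismRingsAbelianSurfaces, §4 p. 290] [cite: ElkiesKumar2014HilbertModularSurfaces, §3] -/
theorem regRep_map_mul_transpose_rungeMatrix_complex (h : 0 ≤ quadDisc k l) (x : QuadraticAlgebra ℤ k l) :
    (regRep k l x).map (Int.cast : ℤ → ℂ) * ((rungeMatrix k l)ᵀ.map ((↑) : ℝ → ℂ)) =
      ((rungeMatrix k l)ᵀ.map ((↑) : ℝ → ℂ)) * Matrix.diagonal (fun i ↦ ((realEmb h i x : ℝ) : ℂ)) := by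
  have h0 := quadRoot_sq_complex h 0
  have h1 := quadRoot_sq_complex h 1
  simp only [realEmb_apply]
  ext i j
  fin_cases i <;> fin_cases j
  · simp [regRep, rungeMatrix, Matrix.mul_apply, Fin.sum_univ_two, Matrix.diagonal]
  · simp [regRep, rungeMatrix, Matrix.mul_apply, Fin.sum_univ_two, Matrix.diagonal]
  · simp [regRep, rungeMatrix, Matrix.mul_apply, Fin.sum_univ_two, Matrix.diagonal]
    linear_combination (-(x.im : ℂ)) * h0
  · simp [regRep, rungeMatrix, Matrix.mul_apply, Fin.sum_univ_two, Matrix.diagonal]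
    linear_combination (-(x.im : ℂ)) * h1

/-- **Eigenvectors over `ℂ`: `A(x)·(1, σᵢ(ω)) = σᵢ(x)·(1, σᵢ(ω))`** — the `i`-th column of `ᵗR` spans the `σᵢ`-eigenline of
every `ι(x)`, `x ∈ O` (the "eigenforms for real multiplication"). [cite: Runge1999EndomorphismRingsAbelianSurfaces, §4 p. 290] [cite: McMullen2003BilliardsTeichmuellerCurves, §6 (eigenforms)] -/
theorem regRep_map_mulVec_eigenvector_complex (h : 0 ≤ quadDisc k l) (x : QuadraticAlgebra ℤ k l) (i : Fin 2) :
    (regRep k l x).map (Int.cast : ℤ → ℂ) *ᵥ ![(1 : ℂ), (quadRoot k l i : ℂ)] =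
      ((realEmb h i x : ℝ) : ℂ) • ![(1 : ℂ), (quadRoot k l i : ℂ)] := by
  have hq := quadRoot_sq_complex h i
  rw [realEmb_apply]
  funext j
  fin_cases j
  · simp [regRep, Matrix.mulVec, dotProduct, Fin.sum_univ_two]
  · simp [regRep, Matrix.mulVec, dotProduct, Fin.sum_univ_two]
    linear_combination (-(x.im : ℂ)) * hq

end AnalyticRep

end SiegelModuli

end Literature.AlgebraicGeometry.ModuliOfAbelianVarieties
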